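import Summits.RiemannHypothesis.RiemannHypothesis.Theorems.WeilWindowFlowWindowLipschitzStubCommutatorBoundAux3

/-!
# Toolkit IV for stub `stub_commutatorBound` (E) of line `cut-dont-squeeze`, crux `WeilWindowFlow.WindowLipschitz`
(item stmt-RiemannHypothesis-1039)

`stub_commutatorBound_norm_one_le`: `‖u‖₁ ≤ (|window| + ∫|u|²)/2` (AM–GM on the window).

`stub_commutatorBound_arch_concrete`: the archimedean commutator term is
`≤ 16 ∫_{a−|x|<6h}|u|² + 2 ‖V‖₁ ∫_{a−|x|<2h}|u|` (pointwise majorant + Tonelli).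

`stub_commutatorBound_core`: the commutator bound for a NORMALISED ground state — `u` measurable,
pointwise zero off `[-a, a]`, pointwise bounded by `K_A`, obeying the `L²` edge-mass law with
constants `K_B, d₀ ≤ 1/4` — and an admissible cutoff `χ` of width `h ≤ min(d₀/16, 1/(16(K_B+1)))`:

  `(arch) + (primes) + (poles) ≤ C(K_A, K_B, A, d₀, S_A) · h`  and  `∫ |χ u|² ≥ 1/2`,

with the explicit constant of the statement. Assembly of Toolkits I–III: pick the dyadic index
`J` with `2^J ≤ d₀/(4h) < 2^{J+1}` (`exists_nat_pow_near`); the layer mass is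
`≤ 2(1+K_B) h/√J` (`stub_commutatorBound_layer_le`), the far-field potential is `≤ C_V √J`
(`stub_commutatorBound_arch_concrete`), and `√J` cancels; primes and poles only need the layer
mass `≤ 2(1+K_B) h`; the mass deficit is `≤ 2 K_B h ≤ 1/2`.

Sources: line card `Lines/cut-dont-squeeze.md` §Stub E; Cycon–Froese–Kirsch–Simon, *Schrödinger
Operators*, Thm. 3.2 (IMS localisation formula).
-/

set_option linter.dupNamespace false

noncomputable section

open MeasureTheory Set Filter
open scoped Topology ENNReal NNReal

namespace Summit.RiemannHypothesis.RiemannHypothesis.Theorems.WeilWindowFlowWindowLipschitz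

open Literature.NumberTheory.LFunctions

/-! ## The `L¹` norm of a window function -/

/-- **`L¹` norm of a window function**: `∫ |u| ≤ (2a + ∫ |u|²)/2` if `u = 0` off `[-a, a]`,
`0 ≤ a` (AM–GM on the window). -/
theorem stub_commutatorBound_norm_one_le :
    ∀ {u : ℝ → ℂ} {a : ℝ}, 0 ≤ a → (∀ x, x ∉ Icc (-a) a → u x = 0) →
      Integrable (fun x ↦ ‖u x‖ ^ 2) → ∫ x, ‖u x‖ ≤ (2 * a + ∫ x, ‖u x‖ ^ 2) / 2 := by
  intro u a ha hu0 hu2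
  have h1 : ∫ x, ‖u x‖ = ∫ x in Icc (-a) a, ‖u x‖ :=
    (setIntegral_eq_integral_of_forall_compl_eq_zero (fun x hx ↦ by
      rw [hu0 x hx, norm_zero])).symm
  have h2 := stub_commutatorBound_setIntegral_norm_le (u := u) measurableSet_Icc measurableSet_Icc
    (measure_Icc_lt_top.ne) (fun x hx _ ↦ hx) hu2.integrableOn one_pos (S := Icc (-a) a)
  have h3 : ∫ x in Icc (-a) a, ‖u x‖ ^ 2 ≤ ∫ x, ‖u x‖ ^ 2 :=
    setIntegral_le_integral hu2 (Eventually.of_forall fun x ↦ by positivity)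
  rw [Real.volume_real_Icc_of_le (by linarith), one_mul, div_one] at h2
  rw [h1]
  linarith

/-! ## The archimedean commutator term, assembled -/

/-- **The archimedean commutator term.** For a measurable window function `u` obeying the
edge-mass law and an admissible cutoff `χ` of width `h` (`2^{J+2} h ≤ d₀ < 2^{J+3} h`):
`∫₀^∞ ρ(t) ∫ (χ(x+t) − χ x)² |u(x+t)| |u x| dx dt
  ≤ 16 ∫_{a−6h<|x|} |u|² + 2 ((1+K) + 8(1+K)√J + ρ(d₀/8) ‖u‖₁) ∫_{a−2h<|x|} |u|`
(`stub_commutatorBound_pointwise` + `stub_commutatorBound_arch_le` with `f = |u| 1_{2h-layer}`,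
`g = |u|² 1_{6h-layer}`, `V = |u| W`, `∫ c ≤ 8`, `stub_commutatorBound_integral_V_le`). -/
theorem stub_commutatorBound_arch_concrete {u : ℝ → ℂ} {χ : ℝ → ℝ} {a d₀ K h : ℝ}
    (hum : Measurable u) (hui : Integrable u) (hu2 : Integrable fun x ↦ ‖u x‖ ^ 2) (hK : 0 ≤ K)
    (hd₀ : 0 < d₀) (hd₁ : d₀ ≤ 1 / 4)
    (hB : ∀ r, 0 < r → r ≤ d₀ → ∫ x in {x | a - r < |x|}, ‖u x‖ ^ 2 ≤ K * r / Real.log (1 / r))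
    (hu0 : ∀ x, x ∉ Icc (-a) a → u x = 0) (hh : 0 < h) (J : ℕ) (hJ : 2 ^ (J + 2) * h ≤ d₀)
    (hJ' : d₀ < 2 ^ (J + 3) * h)
    (hχlip : ∀ x y, |χ x - χ y| ≤ |x - y| / h) (hχ01 : ∀ x, 0 ≤ χ x ∧ χ x ≤ 1)
    (hχ1 : ∀ x, |x| ≤ a - 2 * h → χ x = 1) :
    ∫ t in Ioi (0 : ℝ), weilArchDensity t *
        ∫ x, (χ (x + t) - χ x) ^ 2 * (‖u (x + t)‖ * ‖u x‖) ≤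
      16 * (∫ x in {x | a - 6 * h < |x|}, ‖u x‖ ^ 2) +
        2 * ((1 + K) + 8 * (1 + K) * Real.sqrt J + weilArchDensity (d₀ / 8) * ∫ x, ‖u x‖) *
          ∫ x in {x | a - 2 * h < |x|}, ‖u x‖ := by
  obtain ⟨hVi, hVle⟩ :=
    stub_commutatorBound_integral_V_le hum hui hu2 hK hd₀ hd₁ hB hu0 hh J hJ hJ'
  have h41 : 4 * h ≤ 1 := by
    have : (4 : ℝ) ≤ 2 ^ (J + 2) := by
      calc (4 : ℝ) = 2 ^ 2 := by norm_num
        _ ≤ 2 ^ (J + 2) := pow_le_pow_right₀ (by norm_num) (by omega)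
    nlinarith
  obtain ⟨hc0, hcm, hci, hcle⟩ := stub_commutatorBound_integral_c_le hh h41
  set L2 := {x : ℝ | a - 2 * h < |x|} with hL2
  set L6 := {x : ℝ | a - 6 * h < |x|} with hL6
  have hL2m : MeasurableSet L2 := stub_commutatorBound_measurableSet_layer a _
  have hL6m : MeasurableSet L6 := stub_commutatorBound_measurableSet_layer a _
  have hfm : Measurable (L2.indicator fun x ↦ ‖u x‖) := hum.norm.indicator hL2m
  have hgm : Measurable (L6.indicator fun x ↦ ‖u x‖ ^ 2) := (hum.norm.pow_const 2).indicator hL6m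
  have hf0 : ∀ x, 0 ≤ L2.indicator (fun x ↦ ‖u x‖) x :=
    fun x ↦ indicator_nonneg (fun _ _ ↦ norm_nonneg _) x
  have hg0 : ∀ x, 0 ≤ L6.indicator (fun x ↦ ‖u x‖ ^ 2) x :=
    fun x ↦ indicator_nonneg (fun _ _ ↦ by positivity) x
  have hfi : Integrable (L2.indicator fun x ↦ ‖u x‖) := hui.norm.indicator hL2m
  have hgi : Integrable (L6.indicator fun x ↦ ‖u x‖ ^ 2) := hu2.indicator hL6m
  have hWm : Measurable fun x : ℝ ↦
      (if a - |x| < 4 * h then weilArchDensity (4 * h) else weilArchDensity ((a - |x|) / 2)) :=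
    Measurable.ite (measurableSet_lt (measurable_const.sub continuous_abs.measurable)
      measurable_const) measurable_const (measurable_weilArchDensity.comp
        ((measurable_const.sub continuous_abs.measurable).div_const 2))
  have hW0 : ∀ x, 0 ≤ (if a - |x| < 4 * h then weilArchDensity (4 * h)
      else weilArchDensity ((a - |x|) / 2)) := fun x ↦ by
    split_ifs with hx
    · exact (weilArchDensity_pos (by positivity)).le
    · exact (weilArchDensity_pos (by linarith [not_lt.1 hx])).le
  have hfb : ∀ y, a - |y| < 2 * h → ‖u y‖ ≤ L2.indicator (fun x ↦ ‖u x‖) y := fun y hy ↦ by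
    rw [indicator_of_mem (show y ∈ L2 by show a - 2 * h < |y|; linarith)]
  have hgb : ∀ y, a - |y| < 6 * h → ‖u y‖ ^ 2 ≤ L6.indicator (fun x ↦ ‖u x‖ ^ 2) y :=
    fun y hy ↦ by
    rw [indicator_of_mem (show y ∈ L6 by show a - 6 * h < |y|; linarith)]
  have key : ∫ t in Ioi (0 : ℝ), weilArchDensity t *
        ∫ x, (χ (x + t) - χ x) ^ 2 * (‖u (x + t)‖ * ‖u x‖) ≤
      2 * (∫ t, (Ioc 0 (4 * h)).indicator (fun t ↦ weilArchDensity t * (t / h) ^ 2 / 2) t) *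
          (∫ x, L6.indicator (fun x ↦ ‖u x‖ ^ 2) x) +
        2 * (∫ x, ‖u x‖ * (if a - |x| < 4 * h then weilArchDensity (4 * h)
              else weilArchDensity ((a - |x|) / 2))) *
          ∫ x, L2.indicator (fun x ↦ ‖u x‖) x :=
    stub_commutatorBound_arch_le (ρ := weilArchDensity)
      (Kf := fun t x ↦ (χ (x + t) - χ x) ^ 2 * (‖u (x + t)‖ * ‖u x‖)) hcm hfm hgm
      (hum.norm.mul hWm) hc0 hf0 hg0 (fun x ↦ mul_nonneg (norm_nonneg _) (hW0 x)) hci hfi hgi hVi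
      (fun t ht x ↦ stub_commutatorBound_pointwise hh hu0 hχlip hχ01 hχ1 hf0 hfb hg0 hgb
        hW0 (fun y hy ↦ by rw [if_pos hy]) (fun y hy ↦ by rw [if_neg (not_lt.2 hy)]) ht x)
  have hgnn : 0 ≤ ∫ x, L6.indicator (fun x ↦ ‖u x‖ ^ 2) x := integral_nonneg hg0
  have hfnn : 0 ≤ ∫ x, L2.indicator (fun x ↦ ‖u x‖) x := integral_nonneg hf0
  calc _ ≤ _ := key
    _ ≤ 2 * 8 * (∫ x, L6.indicator (fun x ↦ ‖u x‖ ^ 2) x) +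
        2 * ((1 + K) + 8 * (1 + K) * Real.sqrt J + weilArchDensity (d₀ / 8) * ∫ x, ‖u x‖) *
          ∫ x, L2.indicator (fun x ↦ ‖u x‖) x := by
        gcongr
    _ = _ := by
        rw [integral_indicator hL6m, integral_indicator hL2m]
        ring

/-! ## The core bound -/

/-- **The commutator bound for a normalised ground state.** See the module docstring. -/
theorem stub_commutatorBound_core {u : ℝ → ℂ} {χ : ℝ → ℝ} {a A d₀ KA KB h SA : ℝ}
    (hum : Measurable u) (hu : IsWeilGroundState a u)
    (hu0 : ∀ x, x ∉ Icc (-a) a → u x = 0) (hbd : ∀ x, ‖u x‖ ≤ KA) (hKB : 0 ≤ KB)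
    (hd₀ : 0 < d₀) (hd₁ : d₀ ≤ 1 / 4)
    (hB : ∀ r, 0 < r → r ≤ d₀ → ∫ x in {x | a - r < |x|}, ‖u x‖ ^ 2 ≤ KB * r / Real.log (1 / r))
    (haA : a ≤ A)
    (hSA : ∑ n ∈ weilPrimeIndex a, (ArithmeticFunction.vonMangoldt n : ℝ) / Real.sqrt n ≤ SA)
    (hh : 0 < h) (hhd : 16 * h ≤ d₀) (hhK : 16 * (KB + 1) * h ≤ 1)
    (hχlip : ∀ x y, |χ x - χ y| ≤ |x - y| / h) (hχ01 : ∀ x, 0 ≤ χ x ∧ χ x ≤ 1)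
    (hχ1 : ∀ x, |x| ≤ a - 2 * h → χ x = 1) :
    (∫ t in Ioi (0 : ℝ), weilArchDensity t *
          ∫ x, (χ (x + t) - χ x) ^ 2 * (‖u (x + t)‖ * ‖u x‖)) +
      (∑ n ∈ weilPrimeIndex a, (ArithmeticFunction.vonMangoldt n : ℝ) / Real.sqrt n *
          ∫ x, (χ (x + Real.log n) - χ x) ^ 2 * (‖u (x + Real.log n)‖ * ‖u x‖)) +
      2 * ‖∫ t, ((1 - χ t : ℝ) : ℂ) * u t * (Real.cosh (t / 2) : ℂ)‖ ^ 2 +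
      2 * ‖∫ t, u t * (Real.cosh (t / 2) : ℂ)‖ *
          ‖∫ t, (((1 - χ t) ^ 2 : ℝ) : ℂ) * u t * (Real.cosh (t / 2) : ℂ)‖ +
      2 * ‖∫ t, u t * (Real.sinh (t / 2) : ℂ)‖ *
          ‖∫ t, (((1 - χ t) ^ 2 : ℝ) : ℂ) * u t * (Real.sinh (t / 2) : ℂ)‖ ≤
      (96 * KB + 4 * (9 * (1 + KB) + weilArchDensity (d₀ / 8) * (A + 1 / 2)) * (1 + KB) +
        4 * SA * KA * (1 + KB) + 2 * (2 * Real.cosh (A / 2) * (1 + KB)) ^ 2 +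
        4 * (Real.cosh (A / 2) * (A + 1 / 2)) * (2 * Real.cosh (A / 2) * (1 + KB))) * h ∧
    1 / 2 ≤ ∫ x, ‖(χ x : ℂ) * u x‖ ^ 2 := by
  have ha : 0 < a := hu.pos
  have hA : 0 < A := ha.trans_le haA
  have hKA : 0 ≤ KA := (norm_nonneg _).trans (hbd 0)
  have hui : Integrable u := hu.integrable
  have hu2 : Integrable fun x ↦ ‖u x‖ ^ 2 :=
    (memLp_two_iff_integrable_sq_norm hu.memLp.1).1 hu.memLp
  have hnorm : ∫ x, ‖u x‖ ^ 2 = 1 := hu.integral_norm_sq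
  have hh1 : h ≤ 1 := by
    have : 1 * h ≤ 16 * (KB + 1) * h := mul_le_mul_of_nonneg_right (by linarith) hh.le
    linarith
  -- simplified edge-mass law `∫_{a-r<|x|} |u|² ≤ KB r`
  have hB1 : ∀ r, 0 < r → r ≤ d₀ → ∫ x in {x | a - r < |x|}, ‖u x‖ ^ 2 ≤ KB * r := by
    intro r hr hrd
    have hl : 1 ≤ Real.log (1 / r) := by
      have hq : Real.exp 1 ≤ 1 / r := by
        rw [le_div_iff₀ hr]
        calc Real.exp 1 * r ≤ 2.7182818286 * (1 / 4) :=
              mul_le_mul Real.exp_one_lt_d9.le (hrd.trans hd₁) hr.le (by norm_num)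
          _ ≤ 1 := by norm_num
      simpa using Real.log_le_log (Real.exp_pos 1) hq
    calc _ ≤ KB * r / Real.log (1 / r) := hB r hr hrd
      _ ≤ KB * r / 1 := div_le_div_of_nonneg_left (by positivity) one_pos hl
      _ = KB * r := div_one _
  -- the dyadic index `J`: `2^J ≤ d₀/(4h) < 2^(J+1)`
  obtain ⟨J, hJ1, hJ2⟩ := exists_nat_pow_near (x := d₀ / (4 * h)) (y := (2 : ℝ))
    (by rw [le_div_iff₀ (by positivity)]; linarith) one_lt_two
  have hJa : 2 ^ (J + 2) * h ≤ d₀ := by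
    have := (le_div_iff₀ (by positivity : (0 : ℝ) < 4 * h)).1 hJ1
    calc (2 : ℝ) ^ (J + 2) * h = 2 ^ J * (4 * h) := by ring
      _ ≤ d₀ := this
  have hJb : d₀ < 2 ^ (J + 3) * h := by
    have := (div_lt_iff₀ (by positivity : (0 : ℝ) < 4 * h)).1 hJ2
    calc d₀ < 2 ^ (J + 1) * (4 * h) := this
      _ = 2 ^ (J + 3) * h := by ring
  have hJge : 1 ≤ J := by
    by_contra hJ0
    rw [not_le, Nat.lt_one_iff] at hJ0
    subst hJ0
    have : (4 : ℝ) ≤ d₀ / (4 * h) := by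
      rw [le_div_iff₀ (by positivity)]
      linarith
    norm_num at hJ2
    linarith
  have hJpow : (2 : ℝ) ^ J ≤ 1 / (2 * h) := by
    calc (2 : ℝ) ^ J ≤ d₀ / (4 * h) := hJ1
      _ ≤ 1 / (2 * h) := by
          rw [div_le_div_iff₀ (by positivity) (by positivity)]
          have : d₀ * (2 * h) ≤ 2 * (2 * h) := mul_le_mul_of_nonneg_right (by linarith) (by positivity)
          linarith
  have hsqrtJ : 1 ≤ Real.sqrt J := Real.one_le_sqrt.2 (by exact_mod_cast hJge)
  have hsqrtJpos : 0 < Real.sqrt J := by linarith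
  -- the layer mass `Bf`
  set L2 := {x : ℝ | a - 2 * h < |x|} with hL2
  have hL2m : MeasurableSet L2 := stub_commutatorBound_measurableSet_layer a _
  set Bf := ∫ x in L2, ‖u x‖ with hBf
  have hBf0 : 0 ≤ Bf := integral_nonneg fun x ↦ norm_nonneg _
  have hBfle : Bf ≤ 2 * (1 + KB) * h / Real.sqrt J :=
    stub_commutatorBound_layer_le hu2 hKB hB hu0 hh (by linarith) hJge hJpow
  have hBfle' : Bf ≤ 2 * (1 + KB) * h := hBfle.trans (div_le_self (by positivity) hsqrtJ)
  have hf0 : ∀ x, 0 ≤ L2.indicator (fun x ↦ ‖u x‖) x :=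
    fun x ↦ indicator_nonneg (fun _ _ ↦ norm_nonneg _) x
  have hfb : ∀ y, a - |y| < 2 * h → ‖u y‖ ≤ L2.indicator (fun x ↦ ‖u x‖) y := fun y hy ↦ by
    rw [indicator_of_mem (show y ∈ L2 by show a - 2 * h < |y|; linarith)]
  have hfi : Integrable (L2.indicator fun x ↦ ‖u x‖) := hui.norm.indicator hL2m
  have hintf : ∫ x, L2.indicator (fun x ↦ ‖u x‖) x = Bf := integral_indicator hL2m
  -- `‖u‖₁ ≤ A + 1/2`
  have hL1 : ∫ x, ‖u x‖ ≤ A + 1 / 2 := by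
    have := stub_commutatorBound_norm_one_le ha.le hu0 hu2
    rw [hnorm] at this
    linarith
  have hL1nn : 0 ≤ ∫ x, ‖u x‖ := integral_nonneg fun x ↦ norm_nonneg _
  -- (1) the archimedean term
  set CV := 9 * (1 + KB) + weilArchDensity (d₀ / 8) * (A + 1 / 2) with hCV
  have hρ8 : 0 < weilArchDensity (d₀ / 8) := weilArchDensity_pos (by positivity)
  have hCV0 : 0 ≤ CV := by positivity
  have hBV : (1 + KB) + 8 * (1 + KB) * Real.sqrt J + weilArchDensity (d₀ / 8) * ∫ x, ‖u x‖ ≤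
      CV * Real.sqrt J := by
    have h1 : (1 + KB) ≤ (1 + KB) * Real.sqrt J := le_mul_of_one_le_right (by positivity) hsqrtJ
    have h2 : weilArchDensity (d₀ / 8) * (∫ x, ‖u x‖) ≤
        weilArchDensity (d₀ / 8) * (A + 1 / 2) * Real.sqrt J :=
      calc _ ≤ weilArchDensity (d₀ / 8) * (A + 1 / 2) := mul_le_mul_of_nonneg_left hL1 hρ8.le
        _ ≤ _ := le_mul_of_one_le_right (by positivity) hsqrtJ
    calc _ ≤ (1 + KB) * Real.sqrt J + 8 * (1 + KB) * Real.sqrt J +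
          weilArchDensity (d₀ / 8) * (A + 1 / 2) * Real.sqrt J := by linarith
      _ = CV * Real.sqrt J := by rw [hCV]; ring
  have hT1 : ∫ t in Ioi (0 : ℝ), weilArchDensity t *
        ∫ x, (χ (x + t) - χ x) ^ 2 * (‖u (x + t)‖ * ‖u x‖) ≤
      96 * KB * h + 4 * CV * (1 + KB) * h := by
    have hm6 : ∫ x in {x | a - 6 * h < |x|}, ‖u x‖ ^ 2 ≤ KB * (6 * h) :=
      hB1 _ (by positivity) (by linarith)
    have hBV0 : 0 ≤ (1 + KB) + 8 * (1 + KB) * Real.sqrt J +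
        weilArchDensity (d₀ / 8) * ∫ x, ‖u x‖ := by positivity
    have hprod : ((1 + KB) + 8 * (1 + KB) * Real.sqrt J + weilArchDensity (d₀ / 8) * ∫ x, ‖u x‖) *
        Bf ≤ (CV * Real.sqrt J) * (2 * (1 + KB) * h / Real.sqrt J) :=
      mul_le_mul hBV hBfle hBf0 (by positivity)
    have heq : (CV * Real.sqrt J) * (2 * (1 + KB) * h / Real.sqrt J) = 2 * CV * (1 + KB) * h := by
      field_simp
    calc _ ≤ 16 * (∫ x in {x | a - 6 * h < |x|}, ‖u x‖ ^ 2) +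
          2 * ((1 + KB) + 8 * (1 + KB) * Real.sqrt J + weilArchDensity (d₀ / 8) * ∫ x, ‖u x‖) *
            Bf :=
          stub_commutatorBound_arch_concrete hum hui hu2 hKB hd₀ hd₁ hB hu0 hh J hJa hJb hχlip
            hχ01 hχ1
      _ ≤ 16 * (KB * (6 * h)) + 2 * ((CV * Real.sqrt J) * (2 * (1 + KB) * h / Real.sqrt J)) := by
          have hprod2 := mul_le_mul_of_nonneg_left hprod zero_le_two
          rw [← mul_assoc] at hprod2
          linarith
      _ = 96 * KB * h + 4 * CV * (1 + KB) * h := by rw [heq]; ring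
  -- (2) the prime terms
  have hT2 : ∑ n ∈ weilPrimeIndex a, (ArithmeticFunction.vonMangoldt n : ℝ) / Real.sqrt n *
        ∫ x, (χ (x + Real.log n) - χ x) ^ 2 * (‖u (x + Real.log n)‖ * ‖u x‖) ≤
      SA * (4 * KA * (1 + KB) * h) := by
    have hterm : ∀ n ∈ weilPrimeIndex a,
        (ArithmeticFunction.vonMangoldt n : ℝ) / Real.sqrt n *
          ∫ x, (χ (x + Real.log n) - χ x) ^ 2 * (‖u (x + Real.log n)‖ * ‖u x‖) ≤
        (ArithmeticFunction.vonMangoldt n : ℝ) / Real.sqrt n * (4 * KA * (1 + KB) * h) := by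
      intro n _
      refine mul_le_mul_of_nonneg_left ?_
        (div_nonneg ArithmeticFunction.vonMangoldt_nonneg (Real.sqrt_nonneg _))
      calc _ ≤ 2 * KA * ∫ x, L2.indicator (fun x ↦ ‖u x‖) x :=
            stub_commutatorBound_prime_le hχ01 hχ1 hbd hf0 hfb hfi (Real.log n)
        _ = 2 * KA * Bf := by rw [hintf]
        _ ≤ 2 * KA * (2 * (1 + KB) * h) := by gcongr
        _ = 4 * KA * (1 + KB) * h := by ring
    calc _ ≤ ∑ n ∈ weilPrimeIndex a, (ArithmeticFunction.vonMangoldt n : ℝ) / Real.sqrt n *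
          (4 * KA * (1 + KB) * h) := Finset.sum_le_sum hterm
      _ = (∑ n ∈ weilPrimeIndex a, (ArithmeticFunction.vonMangoldt n : ℝ) / Real.sqrt n) *
          (4 * KA * (1 + KB) * h) := (Finset.sum_mul _ _ _).symm
      _ ≤ SA * (4 * KA * (1 + KB) * h) := mul_le_mul_of_nonneg_right hSA (by positivity)
  -- (3) the pole terms
  set M := Real.cosh (A / 2) with hMdef
  have hM : 0 ≤ M := (Real.cosh_pos _).le
  have hwc : ∀ x, |x| ≤ a → |Real.cosh (x / 2)| ≤ M :=
    fun x hx ↦ (stub_commutatorBound_cosh_sinh_le haA hx).1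
  have hws : ∀ x, |x| ≤ a → |Real.sinh (x / 2)| ≤ M :=
    fun x hx ↦ (stub_commutatorBound_cosh_sinh_le haA hx).2
  have hθ1 : ∀ x, |1 - χ x| ≤ 1 :=
    fun x ↦ abs_le.2 ⟨by linarith [(hχ01 x).2], by linarith [(hχ01 x).1]⟩
  have hθ2 : ∀ x, |(1 - χ x) ^ 2| ≤ 1 := fun x ↦ by
    rw [abs_pow]
    calc |1 - χ x| ^ 2 ≤ 1 ^ 2 := pow_le_pow_left₀ (abs_nonneg _) (hθ1 x) 2
      _ = 1 := one_pow 2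
  have hθ10 : ∀ x, |x| ≤ a - 2 * h → 1 - χ x = 0 := fun x hx ↦ by rw [hχ1 x hx, sub_self]
  have hθ20 : ∀ x, |x| ≤ a - 2 * h → (1 - χ x) ^ 2 = 0 := fun x hx ↦ by
    rw [hθ10 x hx]
    norm_num
  have hP1 : ‖∫ t, ((1 - χ t : ℝ) : ℂ) * u t * (Real.cosh (t / 2) : ℂ)‖ ≤ M * Bf := by
    have := stub_commutatorBound_pole_le (θ := fun t ↦ 1 - χ t) (w := fun t ↦ Real.cosh (t / 2))
      hu0 hθ1 hθ10 hf0 hfb hfi hM hwc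
    rwa [hintf] at this
  have hP2 : ‖∫ t, (((1 - χ t) ^ 2 : ℝ) : ℂ) * u t * (Real.cosh (t / 2) : ℂ)‖ ≤ M * Bf := by
    have := stub_commutatorBound_pole_le (θ := fun t ↦ (1 - χ t) ^ 2)
      (w := fun t ↦ Real.cosh (t / 2)) hu0 hθ2 hθ20 hf0 hfb hfi hM hwc
    rwa [hintf] at this
  have hP3 : ‖∫ t, (((1 - χ t) ^ 2 : ℝ) : ℂ) * u t * (Real.sinh (t / 2) : ℂ)‖ ≤ M * Bf := by
    have := stub_commutatorBound_pole_le (θ := fun t ↦ (1 - χ t) ^ 2)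
      (w := fun t ↦ Real.sinh (t / 2)) hu0 hθ2 hθ20 hf0 hfb hfi hM hws
    rwa [hintf] at this
  have hQ1 : ‖∫ t, u t * (Real.cosh (t / 2) : ℂ)‖ ≤ M * (A + 1 / 2) :=
    (stub_commutatorBound_pairing_le (w := fun t ↦ Real.cosh (t / 2)) hu0 hui hwc).trans
      (mul_le_mul_of_nonneg_left hL1 hM)
  have hQ2 : ‖∫ t, u t * (Real.sinh (t / 2) : ℂ)‖ ≤ M * (A + 1 / 2) :=
    (stub_commutatorBound_pairing_le (w := fun t ↦ Real.sinh (t / 2)) hu0 hui hws).trans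
      (mul_le_mul_of_nonneg_left hL1 hM)
  have hPle : M * Bf ≤ 2 * M * (1 + KB) * h := by
    calc M * Bf ≤ M * (2 * (1 + KB) * h) := mul_le_mul_of_nonneg_left hBfle' hM
      _ = 2 * M * (1 + KB) * h := by ring
  have hT3 : 2 * ‖∫ t, ((1 - χ t : ℝ) : ℂ) * u t * (Real.cosh (t / 2) : ℂ)‖ ^ 2 ≤
      2 * (2 * M * (1 + KB)) ^ 2 * h := by
    have h1 : ‖∫ t, ((1 - χ t : ℝ) : ℂ) * u t * (Real.cosh (t / 2) : ℂ)‖ ≤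
        2 * M * (1 + KB) * h := hP1.trans hPle
    have h2 : ‖∫ t, ((1 - χ t : ℝ) : ℂ) * u t * (Real.cosh (t / 2) : ℂ)‖ ^ 2 ≤
        (2 * M * (1 + KB) * h) ^ 2 := pow_le_pow_left₀ (norm_nonneg _) h1 2
    have h3 : (2 * M * (1 + KB) * h) ^ 2 ≤ (2 * M * (1 + KB)) ^ 2 * h := by
      have : h ^ 2 ≤ h := by
        calc h ^ 2 = h * h := sq h
          _ ≤ 1 * h := mul_le_mul_of_nonneg_right hh1 hh.le
          _ = h := one_mul h
      calc (2 * M * (1 + KB) * h) ^ 2 = (2 * M * (1 + KB)) ^ 2 * h ^ 2 := by ring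
        _ ≤ (2 * M * (1 + KB)) ^ 2 * h := mul_le_mul_of_nonneg_left this (by positivity)
    linarith
  have hT4 : 2 * ‖∫ t, u t * (Real.cosh (t / 2) : ℂ)‖ *
        ‖∫ t, (((1 - χ t) ^ 2 : ℝ) : ℂ) * u t * (Real.cosh (t / 2) : ℂ)‖ ≤
      2 * (M * (A + 1 / 2)) * (2 * M * (1 + KB) * h) :=
    mul_le_mul (mul_le_mul_of_nonneg_left hQ1 zero_le_two) (hP2.trans hPle) (norm_nonneg _)
      (by positivity)
  have hT5 : 2 * ‖∫ t, u t * (Real.sinh (t / 2) : ℂ)‖ *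
        ‖∫ t, (((1 - χ t) ^ 2 : ℝ) : ℂ) * u t * (Real.sinh (t / 2) : ℂ)‖ ≤
      2 * (M * (A + 1 / 2)) * (2 * M * (1 + KB) * h) :=
    mul_le_mul (mul_le_mul_of_nonneg_left hQ2 zero_le_two) (hP3.trans hPle) (norm_nonneg _)
      (by positivity)
  refine ⟨?_, ?_⟩
  · -- assembly
    have hsum := add_le_add (add_le_add (add_le_add (add_le_add hT1 hT2) hT3) hT4) hT5
    refine hsum.trans (le_of_eq ?_)
    rw [hCV]
    ring
  · -- (4) the mass of the cut state
    have hχc : Continuous χ := by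
      refine (LipschitzWith.of_dist_le_mul (K := Real.toNNReal (1 / h)) fun x y ↦ ?_).continuous
      rw [Real.dist_eq, Real.dist_eq, Real.coe_toNNReal _ (by positivity)]
      calc |χ x - χ y| ≤ |x - y| / h := hχlip x y
        _ = 1 / h * |x - y| := by ring
    have hmass := stub_commutatorBound_mass_ge hu.memLp.1 hu2 hχc hχ01 hχ1
    rw [hnorm] at hmass
    have hm2 : ∫ x in {x | a - 2 * h < |x|}, ‖u x‖ ^ 2 ≤ KB * (2 * h) :=
      hB1 _ (by positivity) (by linarith)
    have : KB * (2 * h) ≤ 1 / 2 := by linarith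
    linarith

end Summit.RiemannHypothesis.RiemannHypothesis.Theorems.WeilWindowFlowWindowLipschitz

end
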